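import Literature.Probability.RandomPlanarGeometry.SAWBendingEnergyFekete
import Mathlib.Analysis.MeanInequalities
import Mathlib.Analysis.Convex.Function
import Mathlib.Analysis.SpecialFunctions.Pow.Real
import HarnessLib

/-!
# The shape of the bending free energy `κ(t)`: monotone, log-convex, `κ(1) = log μ` (lane «STIFF», F4 repaired)

Topic `Literature/Probability/RandomPlanarGeometry` (continues `SAWBendingEnergy.lean` — `Zd.turns`, `Zd.Zbend N t =
Σ_{ω ∈ S_N} t^{turns ω}`, `Zd.bendFE t = ⨅_N log(max(1,t) Z_{N+1}(t))/(N+1)` — and `SAWBendingEnergyFekete.lean` —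
F1: `Zd.tendsto_log_Zbend_div : log Z_N(t)/N → κ(t)` for `t > 0`, `Zd.one_le_Zbend`, `Zd.Zbend_pos`).

Semi-flexible self-avoiding walks on `ℤ²` weighted by `t^{#turns}` (Madras–Slade 1993 §2.1 lists the variants; the
objects are the lane's, a-idea-2 gen 8 `Sketch_v7.lean` d87c31580ac19fbc / `Sketch_v7_add3.lean` 538250410b2c94ea).
This file proves the REPAIRED F4 of the route (the frozen `V7.BendFE_shape` asked for `Monotone bendFE` on all of
`ℝ`, false on the junk domain `t ≤ 0`; the repaired statement restricts to `t > 0`):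

* `Zd.bendFE_monotoneOn` (= `V7C.BendFE_monotoneOn`): `κ` is nondecreasing on `(0, ∞)` (termwise);
* `Zd.bendFE_one` (= `V7C.BendFE_at_one`): `κ(1) = log μ(ℤ²)` — both are `lim log c_N / N`
  (`Zbend_one : Z_N(1) = c_N`, F1 at `t = 1`, and the tree's `Zd.tendsto_count_rpow`);
* `Zd.bendFE_exp_convexOn` (= `V7C.BendFE_convex`): `s ↦ κ(e^s)` is convex on `ℝ` — Hölder's inequality
  (`Real.inner_le_Lp_mul_Lq`) makes each `s ↦ log Z_N(e^s)` convex (`log_Zbend_exp_convex`), and `κ(e^s)` is their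
  pointwise limit by F1;
* `Zd.bendFE_shape_pos` — the conjunction (= `V7C.BendFE_shape_pos`).

Printed status: elementary thermodynamic-formalism facts (existence/convexity/monotonicity of a free energy with
nonnegative integer energy); no novelty claimed — support for the lane's STIFF-LIMIT window.
[cite: MadrasSlade1993, §1.2, eqs. (1.2.3)–(1.2.9) and §2.1]
-/

noncomputable section

open Finset Filter Topology
open scoped BigOperators
open Literature.Probability.LatticeModels

namespace Literature.Probability.RandomPlanarGeometry.SAW.Zd

/-! ### F4a: `κ` is nondecreasing on `(0, ∞)` -/

/-- Termwise monotonicity: for `0 < s ≤ t`, `Z_N(s) ≤ Z_N(t)`. [cite: MadrasSlade1993, §1.1] -/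
theorem Zbend_mono {s t : ℝ} (hs : 0 < s) (hst : s ≤ t) (N : ℕ) : Zbend N s ≤ Zbend N t := by
  unfold Zbend
  exact Finset.sum_le_sum fun ω _ => pow_le_pow_left₀ hs.le hst _

/-- The Fekete family is bounded below by `0` (for `t > 0`). [cite: MadrasSlade1993, §1.2, eq. (1.2.9)] -/
theorem bddBelow_range_bendFE_terms {t : ℝ} (ht : 0 < t) :
    BddBelow (Set.range fun N : ℕ => Real.log (max 1 t * Zbend (N + 1) t) / ((N : ℝ) + 1)) := by
  refine ⟨0, ?_⟩
  rintro _ ⟨N, rfl⟩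
  refine div_nonneg (Real.log_nonneg ?_) (by positivity)
  have h1 : 1 ≤ max 1 t := le_max_left _ _
  have h2 := one_le_Zbend (N + 1) ht
  nlinarith

/-- **F4a (repaired) — `κ` is nondecreasing on the physical domain `t > 0`** (lane «STIFF»,
`V7C.BendFE_monotoneOn` verbatim): termwise `max(1,s) Z_N(s) ≤ max(1,t) Z_N(t)` for `0 < s ≤ t`, and `log`,
division by `N` and the infimum are monotone. [cite: MadrasSlade1993, §1.2, eq. (1.2.9) (weighted form)] -/
theorem bendFE_monotoneOn : MonotoneOn bendFE (Set.Ioi 0) := by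
  intro s hs t ht hst
  have hs0 : 0 < s := hs
  have ht0 : 0 < t := ht
  unfold bendFE
  refine ciInf_mono (bddBelow_range_bendFE_terms hs0) fun N => ?_
  have hZs := Zbend_pos (N + 1) hs0
  have hms : 0 < max 1 s := lt_of_lt_of_le one_pos (le_max_left _ _)
  refine div_le_div_of_nonneg_right (Real.log_le_log (mul_pos hms hZs) ?_) (by positivity)
  exact mul_le_mul (max_le_max le_rfl hst) (Zbend_mono hs0 hst (N + 1)) hZs.le
    (le_trans zero_le_one (le_max_left _ _))

/-! ### F4c: `κ(1) = log μ` -/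

/-- At `t = 1` every walk has weight one: `Z_N(1) = c_N`. [cite: MadrasSlade1993, §1.1] -/
theorem Zbend_one (N : ℕ) : Zbend N 1 = count 2 N := by
  unfold Zbend
  simp [card_saws]

/-- **F4c — `κ(1) = log μ(ℤ²)`** (lane «STIFF», `V7C.BendFE_at_one` verbatim): both sides are the limit of
`log c_N / N` (`Zd.tendsto_log_Zbend_div` at `t = 1`, and `c_N^{1/N} → μ`, `Zd.tendsto_count_rpow`).
[cite: MadrasSlade1993, §1.2, eqs. (1.2.1), (1.2.9)] -/
theorem bendFE_one : bendFE 1 = Real.log (connectiveConstant 2) := by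
  have h1 : Tendsto (fun N : ℕ => Real.log (Zbend N 1) / N) atTop (𝓝 (bendFE 1)) :=
    tendsto_log_Zbend_div one_pos
  have hμ : 0 < connectiveConstant 2 := connectiveConstant_pos 2
  have h2 : Tendsto (fun N : ℕ => Real.log (Zbend N 1) / N) atTop (𝓝 (Real.log (connectiveConstant 2))) := by
    have h := (Real.continuousAt_log hμ.ne').tendsto.comp (tendsto_count_rpow 2)
    refine h.congr' ?_
    filter_upwards [eventually_ge_atTop 1] with N hN
    have hc : (0 : ℝ) < count 2 N := by exact_mod_cast one_le_count 2 N
    simp only [Function.comp_apply]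
    rw [Real.log_rpow hc, Zbend_one, one_div, inv_mul_eq_div]
  exact tendsto_nhds_unique h1 h2

/-! ### F4b: `s ↦ κ(e^s)` is convex -/

/-- `Z_N(e^s)` as an exponential sum: `Z_N(e^s) = Σ_ω e^{s · turns ω}`. [cite: MadrasSlade1993, §1.1] -/
theorem Zbend_exp (N : ℕ) (s : ℝ) : Zbend N (Real.exp s) = ∑ ω ∈ saws 2 N, Real.exp (s * turns N ω) := by
  unfold Zbend
  refine Finset.sum_congr rfl fun ω _ => ?_
  rw [← Real.exp_nat_mul, mul_comm]

/-- **Hölder on each partition function**: for `a, b ≥ 0`, `a + b = 1`,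
`log Z_N(e^{a x + b y}) ≤ a log Z_N(e^x) + b log Z_N(e^y)` — `s ↦ log Z_N(e^s)` is convex (log-sum-exp).
[cite: MadrasSlade1993, §1.1] -/
theorem log_Zbend_exp_convex (N : ℕ) {x y a b : ℝ} (ha : 0 ≤ a) (hb : 0 ≤ b) (hab : a + b = 1) :
    Real.log (Zbend N (Real.exp (a * x + b * y))) ≤
      a * Real.log (Zbend N (Real.exp x)) + b * Real.log (Zbend N (Real.exp y)) := by
  have hZx := Zbend_pos N (Real.exp_pos x)
  have hZy := Zbend_pos N (Real.exp_pos y)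
  -- degenerate weights
  rcases ha.eq_or_lt with rfl | ha0
  · have hb1 : b = 1 := by linarith
    subst hb1; simp
  rcases hb.eq_or_lt with rfl | hb0
  · have ha1 : a = 1 := by linarith
    subst ha1; simp
  -- Hölder with exponents `1/a`, `1/b`
  have hpq : (a⁻¹).HolderConjugate b⁻¹ := Real.HolderConjugate.inv_inv ha0 hb0 hab
  have key : Zbend N (Real.exp (a * x + b * y)) ≤ Zbend N (Real.exp x) ^ a * Zbend N (Real.exp y) ^ b := by
    have h := Real.inner_le_Lp_mul_Lq (saws 2 N) (fun ω => Real.exp (a * (x * turns N ω)))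
      (fun ω => Real.exp (b * (y * turns N ω))) hpq
    have hf : ∀ ω : ℕ → Site 2, |Real.exp (a * (x * turns N ω))| ^ a⁻¹ = Real.exp (x * turns N ω) := by
      intro ω
      rw [abs_of_pos (Real.exp_pos _), ← Real.exp_mul, mul_comm a, mul_assoc, mul_inv_cancel₀ ha0.ne', mul_one]
    have hg : ∀ ω : ℕ → Site 2, |Real.exp (b * (y * turns N ω))| ^ b⁻¹ = Real.exp (y * turns N ω) := by
      intro ω
      rw [abs_of_pos (Real.exp_pos _), ← Real.exp_mul, mul_comm b, mul_assoc, mul_inv_cancel₀ hb0.ne', mul_one]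
    have hfg : ∀ ω : ℕ → Site 2, Real.exp (a * (x * turns N ω)) * Real.exp (b * (y * turns N ω)) =
        Real.exp ((a * x + b * y) * turns N ω) := by
      intro ω; rw [← Real.exp_add]; ring_nf
    simp only [hf, hg, hfg, one_div, inv_inv] at h
    rw [Zbend_exp, Zbend_exp, Zbend_exp]
    exact h
  have hlog := Real.log_le_log (Zbend_pos N (Real.exp_pos _)) key
  rw [Real.log_mul (Real.rpow_pos_of_pos hZx a).ne' (Real.rpow_pos_of_pos hZy b).ne',
    Real.log_rpow hZx, Real.log_rpow hZy] at hlog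
  exact hlog

/-- **F4b — `s ↦ κ(e^s)` is convex on `ℝ`** (lane «STIFF», `V7C.BendFE_convex` verbatim): each
`s ↦ N⁻¹ log Z_N(e^s)` is convex (`log_Zbend_exp_convex`) and `κ(e^s)` is their pointwise limit
(`Zd.tendsto_log_Zbend_div`, F1). [cite: MadrasSlade1993, §1.2, eq. (1.2.9) (weighted form)] -/
theorem bendFE_exp_convexOn : ConvexOn ℝ Set.univ (fun s : ℝ => bendFE (Real.exp s)) := by
  refine ⟨convex_univ, fun x _ y _ a b ha hb hab => ?_⟩
  have hlim := fun s : ℝ => tendsto_log_Zbend_div (Real.exp_pos s)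
  have h3 : Tendsto (fun N : ℕ => a * (Real.log (Zbend N (Real.exp x)) / N) +
      b * (Real.log (Zbend N (Real.exp y)) / N)) atTop
      (𝓝 (a * bendFE (Real.exp x) + b * bendFE (Real.exp y))) :=
    ((hlim x).const_mul a).add ((hlim y).const_mul b)
  refine le_of_tendsto_of_tendsto' (hlim (a • x + b • y)) h3 fun N => ?_
  simp only [smul_eq_mul]
  have h := log_Zbend_exp_convex N (x := x) (y := y) ha hb hab
  have hN : (0 : ℝ) ≤ N := Nat.cast_nonneg N
  calc Real.log (Zbend N (Real.exp (a * x + b * y))) / N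
      ≤ (a * Real.log (Zbend N (Real.exp x)) + b * Real.log (Zbend N (Real.exp y))) / N :=
        div_le_div_of_nonneg_right h hN
    _ = a * (Real.log (Zbend N (Real.exp x)) / N) + b * (Real.log (Zbend N (Real.exp y)) / N) := by ring

/-- **F4 repaired (a-idea-2 `V7C.BendFE_shape_pos`)**: `κ` is nondecreasing on `(0,∞)`, `s ↦ κ(e^s)` is convex,
and `κ(1) = log μ`. [cite: MadrasSlade1993, §1.2] -/
theorem bendFE_shape_pos :
    MonotoneOn bendFE (Set.Ioi 0) ∧ ConvexOn ℝ Set.univ (fun s : ℝ => bendFE (Real.exp s)) ∧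
      bendFE 1 = Real.log (connectiveConstant 2) :=
  ⟨bendFE_monotoneOn, bendFE_exp_convexOn, bendFE_one⟩

end Literature.Probability.RandomPlanarGeometry.SAW.Zd

end
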